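import Literature.AnabelianGeometry.EtaleTheta.SettingModelMuTwoInversion
import Literature.AnabelianGeometry.EtaleTheta.Discharge.Sec1Prop18
import HarnessLib

/-!
# [EtTh] §1, Prop. 1.8 and `PreservesCoverings` as SCHEMATA over `MuTwoSetting`: the universal closures
# are REFUTED in the kernel (two Def-1.7 models with the same `Π^tp_Ẋ` and no `Π^tp_C`-isomorphism over `X`)

Mochizuki, *The étale theta function …*, Publ. RIMS **45** (2009), §1, Def. 1.7 p. 27, Prop. 1.8 p. 28
(printed 253–254) [cite: MochizukiEtTh2009, Prop 1.8 p.28]. abc-iut cell, block F (fact-proving wave,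
LADDER-ABC:A2.C), seat abc-iut-f-114, FACT-LIST rows F-1396 `Prop18` and F-2483 `PreservesCoverings` of
`ConstantMultipleRigidity.lean` (abc-iut-L2-t1); companion file `Sec1Prop18InstanceForms.lean` records the
instance forms that hold (and row F-0514 `Thm110ii`). PROOF-ONLY: no `def`, no instance, no new named fact;
the trunk file and the two Def-1.7 models (`MuTwoSetting.model p`, abc-iut-L2-t1, `SettingModelMuTwo`;
`MuTwoSetting.inversionModel p`, abc-iut-w5-d072, `SettingModelMuTwoInversion`) are imported, never edited.

Both rows are PARAMETRISED (`kernel_closedness = parametrised`): predicates on an isomorphism `γ`/`Γ`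
between two ABSTRACT `MuTwoSetting`s. Rule R5 of the FACT-LIST: a universal closure of such a schema is not
a fact — it is refuted in the kernel or holds at named instances only. Kernel content of this file:

**(A) The universal closure of Prop. 1.8 (`Ẋ`-case) is FALSE over the interface** (`not_forall_prop18`).
The two models of Def. 1.7 over the SAME root `ThetaSetting.model p` — `Π^tp_C := Π^tp_X × ℤ/2` (`ε_±`
central) and `Π^tp_C := Π^tp_X ⋊_ι ℤ/2` (`ε_±` the inversion `a ↦ a⁻¹, b ↦ b⁻¹`) — have the SAME `Π^tp_X`,
`Π^tp_Ẍ` and, for the admissible `ε_Z := a`, isomorphic `Π^tp_Ẋ` (`nonempty_dotX_equiv_model_inversionModel`: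
both are images of `Π^tp_Ẍ ⊔ ⟨a⟩ ≤ Π^tp_X`), but NO group isomorphism `Γ : Π^tp_{Cα} →̃ Π^tp_{Cβ}` carries
`Π^tp_{Xα}` onto `Π^tp_{Xβ}` (`SettingModel.map_range_inclXM_ne`: the central element `(1, 1̄) ∉ Π^tp_X` of the
product would go to a central element `(n, 1̄)` of the semidirect product, forcing `n · ι(a) = a · n`, which
`toZ : Π^tp_X ↠ ℤ` refutes: `toZ (ι a) = −1 ≠ 1 = toZ a`). Hence `PreservesCoverings` fails for EVERY `Γ`
between the two models (`not_preservesCoverings_model_inversionModel`) and `Prop18` fails for EVERY `γ`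
(`not_prop18_model_inversionModel`). READING: the interface `MuTwoSetting` does not determine
`Π^tp_C ⊇ Π^tp_Ẋ` from `Π^tp_Ẋ`; in print this is the anabelian input "by [SemiAnbd] Theorem 6.8, (ii), it
follows from condition (II) [`C` is a `K`-core] that `γ` induces an isomorphism `Π^tp_{Cα} →̃ Π^tp_{Cβ}` that
is compatible with `γ`" (p. 28), which has no carrier in the tree (`Discharge/Sec1Prop18.lean`, input (a)).
(The `Ċ`-case `Prop18pm`, row F-0511 of tranche 113, is NOT settled by this pair: `Π^tp_Ċ` of the inversion
model contains the involution `ε_μ ε_±`, so its binder `γ : Π^tp_{Ċα} →̃ Π^tp_{Ċβ}` may be empty here; a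
refutation inside the product model alone — `ε_{Z,α} := a`, `ε_{Z,β} := a ε_μ`, `γ :=` the change of the
`ℤ/2`-coordinate through the first projection `Π^tp_Ċ →̃ Π^tp_X` — is left to its holder.)

**(B) `PreservesCoverings` is not automatic even for `Γ = id`** (`not_preservesCoverings_refl_mul_epsMu`):
inside ONE `Π^tp_C` the two admissible choices `ε_Z`, `ε_Z ε_μ` (Def. 1.7: "for some choice of `ε_Z`") give
DIFFERENT `Π^tp_Ẋ` (`dotX_ne_dotX_mul_epsMu`), so the identity does not match their diagrams; hence
`not_forall_preservesCoverings` (at `MuTwoSetting.model p`, which exists for every prime).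

HONEST FRAMING: statements about OUR typed schemata at OUR (degenerate, discrete) models; a refuted
universal closure says the INTERFACE is too weak to carry the printed hypothesis (condition (II),
`K`-coricity), not that Prop. 1.8 is false; the rows remain admissible AT NAMED INSTANCES; typed ≠ proved;
no side is taken on [IUTchIII] Cor. 3.12 or on any author.
-/

noncomputable section

namespace Literature.AnabelianGeometry.EtaleTheta

open Literature.AnabelianGeometry.SemiGraphs

/-! ## (A) The two Def-1.7 models over the root model share `Π^tp_Ẋ` but no `Π^tp_C`-isomorphism over `X` -/

namespace SettingModel

variable (p : ℕ) [Fact p.Prime]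

/-- **No isomorphism `Π^tp_X × ℤ/2 →̃ Π^tp_X ⋊_ι ℤ/2` carries `Π^tp_X` onto `Π^tp_X`.** The element
`z = (1, 1̄)` of the product model is central and not over `X`; its image would be a central element
`(n, 1̄)` of the semidirect product, whence `n · ι(x) = x · n` on `Π^tp_X`, i.e. `ι` inner — but
`toZ (ι a) = (toZ a)⁻¹ ≠ toZ a` for the generator `a` (`toZ a = 1 ∈ ℤ`). This is the kernel form of "the
interface does not determine `Π^tp_C` from `Π^tp_X`" (print supplies it by [SemiAnbd] Thm. 6.8 (ii) +
condition (II), p. 28). [cite: MochizukiEtTh2009, Prop 1.8 p.28] -/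
theorem map_range_inclXM_ne (Γ : PiC p ≃* PiCInv p) :
    (inclXM p).range.map Γ.toMonoidHom ≠ (inclInv p).range := by
  intro hX
  -- the central element `z = (1, 1̄)` of `Π^tp_X × ℤ/2`, not over `X`
  have hzX : ((1, Multiplicative.ofAdd (1 : ZMod 2)) : PiC p) ∉ (inclXM p).range := by
    rw [range_inclXM]
    rintro ⟨-, h2⟩
    have h2' : Multiplicative.ofAdd (1 : ZMod 2) = 1 := Subgroup.mem_bot.mp h2
    exact absurd h2' (by decide)
  have hzc : ∀ g : PiC p, g * (1, Multiplicative.ofAdd (1 : ZMod 2)) =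
      (1, Multiplicative.ofAdd (1 : ZMod 2)) * g :=
    fun g => Prod.ext (by simp) (mul_comm _ _)
  -- its image `w` is not over `X` …
  have hwX : Γ (1, Multiplicative.ofAdd 1) ∉ (inclInv p).range := by
    intro h
    rw [← hX] at h
    obtain ⟨x, hx, hxz⟩ := h
    have hx' : x = (1, Multiplicative.ofAdd 1) := Γ.injective hxz
    rw [hx'] at hx
    exact hzX hx
  -- … so its `ℤ/2`-component is the generator
  have hright : SemidirectProduct.right (Γ (1, Multiplicative.ofAdd 1)) = Multiplicative.ofAdd 1 := by
    have key : ∀ t : Multiplicative (ZMod 2), t = 1 ∨ t = Multiplicative.ofAdd 1 := by decide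
    rcases key (SemidirectProduct.right (Γ (1, Multiplicative.ofAdd 1))) with h | h
    · exfalso
      apply hwX
      rw [range_inclInv, MonoidHom.mem_ker]
      exact h
    · exact h
  -- centrality against `inl a`: `a · n = n · ι(a)` in `Π^tp_X`
  have hcomm : inclInv p (genA p) * Γ (1, Multiplicative.ofAdd 1) =
      Γ (1, Multiplicative.ofAdd 1) * inclInv p (genA p) := by
    have h := congrArg Γ (hzc (Γ.symm (inclInv p (genA p))))
    rwa [map_mul, map_mul, MulEquiv.apply_symm_apply] at h
  have hleft := congrArg SemidirectProduct.left hcomm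
  change genA p * (inversionAction p 1) (SemidirectProduct.left (Γ (1, Multiplicative.ofAdd 1))) =
      SemidirectProduct.left (Γ (1, Multiplicative.ofAdd 1)) *
        inversionAction p (SemidirectProduct.right (Γ (1, Multiplicative.ofAdd 1))) (genA p) at hleft
  rw [map_one, MulAut.one_apply, hright, inversionAction_ofAdd_one] at hleft
  -- apply `toZ : Π^tp_X ↠ ℤ` (`toZ a = 1`, `toZ (ι a) = -1`)
  have hZ := congrArg (toZM p) hleft
  rw [map_mul, map_mul] at hZ
  have hιa : toZM p ((inversionM p).toMulEquiv (genA p)) = (toZM p (genA p))⁻¹ := toZ_inversion p (genA p)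
  have ha : toZM p (genA p) = Multiplicative.ofAdd 1 := toZ_genA p
  rw [hιa, ha, mul_comm] at hZ
  have h1 : (Multiplicative.ofAdd (1 : ℤ)) = (Multiplicative.ofAdd (1 : ℤ))⁻¹ := mul_left_cancel hZ
  have h2 := congrArg Multiplicative.toAdd h1
  simp only [toAdd_ofAdd, toAdd_inv] at h2
  omega

/-- The `Π^tp_Ẋ` of `ε_Z := a` is the image of ONE subgroup `Π^tp_Ẍ ⊔ ⟨a⟩ ≤ Π^tp_X` in the product model …
[cite: MochizukiEtTh2009, Def 1.7 p.27] -/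
theorem dotX_model_eq_map :
    (MuTwoSetting.model p).dotX (inclXM p (Del.ofF₂ (FreeGroup.of 0), 1)) =
      (Xdd p ⊔ Subgroup.zpowers (genA p)).map (inclXM p) := by
  rw [Subgroup.map_sup, MonoidHom.map_zpowers]
  rfl

/-- … and in the inversion model. [cite: MochizukiEtTh2009, Def 1.7 p.27] -/
theorem dotX_inversionModel_eq_map :
    (MuTwoSetting.inversionModel p).dotX (inclInv p (Del.ofF₂ (FreeGroup.of 0), 1)) =
      (Xdd p ⊔ Subgroup.zpowers (genA p)).map (inclInv p) := by
  rw [Subgroup.map_sup, MonoidHom.map_zpowers]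
  rfl

/-- **The binder `γ : Π^tp_{Ẋα} →̃ Π^tp_{Ẋβ}` of Prop. 1.8 is INHABITED at the pair (product model,
inversion model)** with the admissible `ε_Z := a` on both sides: both `Π^tp_Ẋ` are isomorphic images of
`Π^tp_Ẍ ⊔ ⟨a⟩ ≤ Π^tp_X` (everything discrete). [cite: MochizukiEtTh2009, Prop 1.8 p.28] -/
theorem nonempty_dotX_equiv_model_inversionModel :
    Nonempty ((MuTwoSetting.model p).dotX (inclXM p (Del.ofF₂ (FreeGroup.of 0), 1)) ≃ₜ*
      (MuTwoSetting.inversionModel p).dotX (inclInv p (Del.ofF₂ (FreeGroup.of 0), 1))) := by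
  refine ⟨{ toMulEquiv :=
              ((MulEquiv.subgroupCongr (dotX_model_eq_map p)).trans
                ((Xdd p ⊔ Subgroup.zpowers (genA p)).equivMapOfInjective (inclXM p)
                  (MuTwoSetting.model p).injective_inclX).symm).trans
              (((Xdd p ⊔ Subgroup.zpowers (genA p)).equivMapOfInjective (inclInv p)
                  (MuTwoSetting.inversionModel p).injective_inclX).trans
                (MulEquiv.subgroupCongr (dotX_inversionModel_eq_map p)).symm)
            continuous_toFun := continuous_of_discreteTopology
            continuous_invFun := continuous_of_discreteTopology }⟩

end SettingModel

section Prop18Closure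

open SettingModel

variable (p : ℕ) [Fact p.Prime]

/-- **`PreservesCoverings` fails for EVERY `Γ` between the product model and the inversion model** (any
`ε_{Z,α}`, `ε_{Z,β}`): already its clause `Γ(Π^tp_{Xα}) = Π^tp_{Xβ}` is unsatisfiable
(`SettingModel.map_range_inclXM_ne`). [cite: MochizukiEtTh2009, Prop 1.8 p.28] -/
theorem not_preservesCoverings_model_inversionModel (εα : (MuTwoSetting.model p).GtpC)
    (εβ : (MuTwoSetting.inversionModel p).GtpC)
    (Γ : (MuTwoSetting.model p).GtpC ≃ₜ* (MuTwoSetting.inversionModel p).GtpC) :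
    ¬ PreservesCoverings εα εβ Γ := fun h =>
  SettingModel.map_range_inclXM_ne p Γ.toMulEquiv h.map_X

/-- **Prop. 1.8 (`Ẋ`-case) FAILS as typed at the pair (product model, inversion model)**, for every
admissibility datum and EVERY `γ : Π^tp_{Ẋα} →̃ Π^tp_{Ẋβ}`: no extension `Γ` can preserve the coverings.
[cite: MochizukiEtTh2009, Prop 1.8 p.28] -/
theorem not_prop18_model_inversionModel {εα : (MuTwoSetting.model p).GtpC}
    {εβ : (MuTwoSetting.inversionModel p).GtpC} (hα : (MuTwoSetting.model p).IsAdmissibleEpsZ εα)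
    (hβ : (MuTwoSetting.inversionModel p).IsAdmissibleEpsZ εβ)
    (γ : (MuTwoSetting.model p).dotX εα ≃ₜ* (MuTwoSetting.inversionModel p).dotX εβ) :
    ¬ Prop18 hα hβ γ := fun ⟨Γ, hΓ, _⟩ =>
  not_preservesCoverings_model_inversionModel p εα εβ Γ hΓ

/-- **R5 verdict for F-1396: the universal closure of the schema `Prop18` is REFUTED** (for every prime
`p`): the binder `γ` is inhabited at the pair (product model, inversion model) with `ε_Z := a` admissible on
both sides, and `Prop18` fails there. The row is consumable at NAMED instances only.
[cite: MochizukiEtTh2009, Prop 1.8 p.28] -/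
theorem not_forall_prop18 :
    ¬ ∀ (Mα Mβ : MuTwoSetting p) (εα : Mα.GtpC) (εβ : Mβ.GtpC) (hα : Mα.IsAdmissibleEpsZ εα)
        (hβ : Mβ.IsAdmissibleEpsZ εβ) (γ : Mα.dotX εα ≃ₜ* Mβ.dotX εβ), Prop18 hα hβ γ := by
  intro h
  obtain ⟨γ⟩ := nonempty_dotX_equiv_model_inversionModel p
  exact not_prop18_model_inversionModel p (MuTwoSetting.model_isAdmissibleEpsZ p)
    (MuTwoSetting.inversionModel_isAdmissibleEpsZ p) γ
    (h _ _ _ _ (MuTwoSetting.model_isAdmissibleEpsZ p) (MuTwoSetting.inversionModel_isAdmissibleEpsZ p) γ)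

end Prop18Closure

/-! ## (B) `PreservesCoverings` depends on matching the choices of `ε_Z` -/

namespace MuTwoSetting

variable {p : ℕ} [Fact p.Prime] (M : MuTwoSetting p)

/-- **The two admissible choices give different curves `Ẋ`**: `Π^tp_Ẍ ⊔ ⟨ε_Z⟩ ≠ Π^tp_Ẍ ⊔ ⟨ε_Z ε_μ⟩`
(`ε_Z` lies in the first but not in the second, as `ε_μ ∉ Π^tp_Ẍ`; Def. 1.7 "for some choice of `ε_Z`",
p. 27). [cite: MochizukiEtTh2009, Def 1.7 p.27] -/
theorem dotX_ne_dotX_mul_epsMu {εZ : M.GtpC} (hZ : M.IsAdmissibleEpsZ εZ) :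
    M.dotX εZ ≠ M.dotX (εZ * M.epsMu) := by
  intro h
  have hmem : εZ ∈ M.dotX (εZ * M.epsMu) := h ▸ Subgroup.mem_sup_right (Subgroup.mem_zpowers εZ)
  haveI := M.map_GtpXdd_normal
  rcases (M.mem_dotX_iff (εZ * M.epsMu) εZ).1 hmem with h1 | h1
  · exact hZ.2.1 h1
  · apply M.epsMu_not_mem
    have h2 : εZ * (εZ * M.epsMu)⁻¹ = εZ * M.epsMu⁻¹ * εZ⁻¹ := by group
    rw [h2] at h1
    have h3 := Subgroup.Normal.conj_mem inferInstance _ h1 εZ⁻¹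
    rw [inv_inv] at h3
    have h4 : εZ⁻¹ * (εZ * M.epsMu⁻¹ * εZ⁻¹) * εZ = M.epsMu⁻¹ := by group
    rw [h4] at h3
    exact (Subgroup.inv_mem_iff _).1 h3

/-- **The identity of `Π^tp_C` does NOT preserve the coverings when the two sides use the two different
admissible `ε_Z`** (its clause `Γ(Π^tp_{Ẋα}) = Π^tp_{Ẋβ}` reads `Π^tp_Ẍ ⊔ ⟨ε_Z⟩ = Π^tp_Ẍ ⊔ ⟨ε_Z ε_μ⟩`).
[cite: MochizukiEtTh2009, Prop 1.8 p.28] -/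
theorem not_preservesCoverings_refl_mul_epsMu {εZ : M.GtpC} (hZ : M.IsAdmissibleEpsZ εZ) :
    ¬ PreservesCoverings εZ (εZ * M.epsMu) (ContinuousMulEquiv.refl M.GtpC) := fun h =>
  have h2 : (M.dotX εZ).map (ContinuousMulEquiv.refl M.GtpC).toMulEquiv.toMonoidHom = M.dotX εZ :=
    Subgroup.map_id _
  M.dotX_ne_dotX_mul_epsMu hZ (h2.symm.trans h.map_dotX)

/-- **R5 verdict for F-2483: the universal closure of the schema `PreservesCoverings` is REFUTED** — inside
every `MuTwoSetting` (such exist for every prime: `MuTwoSetting.model p`), at `Γ = id` and the two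
admissible `ε_Z`'s (`exists_isAdmissibleEpsZ`, `IsAdmissibleEpsZ.mul_epsMu`). NAMED instances only.
[cite: MochizukiEtTh2009, Prop 1.8 p.28] -/
theorem not_forall_preservesCoverings :
    ¬ ∀ (Mα Mβ : MuTwoSetting p) (εα : Mα.GtpC) (εβ : Mβ.GtpC) (Γ : Mα.GtpC ≃ₜ* Mβ.GtpC),
        PreservesCoverings εα εβ Γ := by
  intro h
  obtain ⟨εZ, hZ⟩ := (MuTwoSetting.model p).exists_isAdmissibleEpsZ
  exact (MuTwoSetting.model p).not_preservesCoverings_refl_mul_epsMu hZ (h _ _ _ _ _)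

end MuTwoSetting

end Literature.AnabelianGeometry.EtaleTheta

end
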